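import Summits.ResolutionOfSingularities.ResolutionOfSingularities.Theorems.WeightedInvariantHypersurfaceAdmissibleSequences
import Summits.ResolutionOfSingularities.ResolutionOfSingularities.Theorems.WeightedInvariantWeightedThesisTowerGenericAmbient
import Summits.ResolutionOfSingularities.ResolutionOfSingularities.Theorems.WeightedInvariantWeightedThesisHypersurfacePreserved
import Summits.ResolutionOfSingularities.ResolutionOfSingularities.Theorems.WeightedInvariantWeightedConstructionCobordantBlowupRegular
import HarnessLib

/-!
# The successor of a hypersurface pair along an ADMISSIBLE centre is again a hypersurface pair

Route `ResolutionOfSingularities/WeightedInvariant`, crux `Theses.WeightedInvariant.HypersurfaceCentreConstruction`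
(stmt-ResolutionOfSingularities-19897), door line `local-engine`; after-care of the ∃-form
(`Theorems/…HypersurfaceAdmissibleSequences.lean`, `…AdmissibleSequencesOfDatum.lean`).  In
`HypersurfacePair.AdmissiblyResolvable (n + 1) P` the goodness of the successor (`B₊ → Spec k` smooth
separated quasi-compact, strict transform locally principal with integral zero locus) is recorded as DATA, as
in `HypersurfacePair.Step`.  This file discharges that data from admissibility alone, over a perfect field, by
the tree's tower facts (tri-2 TRIAGE v3 O-v3.4 «for an admissible centre the successor pair is again good»):

* `IsAdmissibleCentre.filtration` — the Rees filtration with the pieces of an admissible centre (pieces of a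
  regular weighted centre are antitone, `antitone_piece`);
* `not_mem_singImage_subschemeι_genericPoint` — the image of the generic point of the integral `V(X)` is not
  in `singImage X` (its local ring is the function field); hence `(iii-b′)` puts it off every admissible
  centre (`IsAdmissibleCentre.genericPoint_not_mem_support`);
* `IsAdmissibleCentre.isHypersurfacePair_successor` — the successor along `hadm.filtration` is a
  hypersurface pair (`WeightedThesis.GlobalCobordantPlus.smooth_πPlus_comp_of_isRegularWeightedCentre`,
  `WeightedThesis.HypersurfacePreserved.isLocallyPrincipal_strictTransformPlus`,
  `DatumToEmbedded.StrictTransform.isIntegral_strictTransformPlus_of_not_mem_support`);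
* `HypersurfacePair.admissiblyResolvable_succ_of_admissible` — to resolve `P` admissibly in `n + 1` steps it
  suffices to give an admissible centre whose successor is admissibly resolvable in `n` steps: the ∃-DOOR is
  bookkeeping-free for its provers (exhibit admissible centres, check the final regularity).

Nothing here is a claim about Hironaka's problem.
-/

noncomputable section

open CategoryTheory AlgebraicGeometry TopologicalSpace
open Literature.AlgebraicGeometry.Resolution

set_option linter.dupNamespace false -- mandated namespace of this single-conjunct summit

namespace Summit.ResolutionOfSingularities.ResolutionOfSingularities.Theorems

/-! ## The generic point of the hypersurface is off every admissible centre -/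

/-- **The image of the generic point of the integral `V(X)` is not in `singImage X`**: the only point of
`V(X)` over it is the generic point itself (the inclusion is injective), whose local ring — the function
field — is regular. [folklore] -/
theorem not_mem_singImage_subschemeι_genericPoint {Y : Scheme.{0}} (X : Y.IdealSheafData)
    [IsIntegral X.subscheme] : X.subschemeι (genericPoint X.subscheme) ∉ singImage X := by
  rintro ⟨x, hx, hreg⟩
  have hx' : x = genericPoint X.subscheme := X.subschemeι.isClosedEmbedding.injective hx
  subst hx'
  exact hreg (show IsRegularLocalRing (X.subscheme : Scheme.{0}).functionField from inferInstance)

namespace IsAdmissibleCentre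

variable {k : Type} [Field k] {Y : Scheme.{0}} {f : Y ⟶ Spec (.of k)} {X : Y.IdealSheafData}
  {R : ReesAlgebraData Y}

/-- `(iii-a)` of an admissible centre. [folklore] -/
theorem isRegularWeightedCentre (hadm : IsAdmissibleCentre f X R) : R.IsRegularWeightedCentre := hadm.1

/-- `(iii-b′)` of an admissible centre. [folklore] -/
theorem support_subset_singImage (hadm : IsAdmissibleCentre f X R) : R.support ⊆ singImage X := hadm.2.1

/-- `(hom)` of an admissible centre. [folklore] -/
theorem piece_isHomogeneous (hadm : IsAdmissibleCentre f X R) {j : ℕ} (W : Y.affineOpens)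
    (𝒜 : (Fin j → ℤ) → AddSubgroup Γ(Y, W)) [GradedRing 𝒜]
    (h0 : ∀ c : Γ(Spec (.of k), ⊤), f.appLE ⊤ W le_top c ∈ 𝒜 0) (hX : (X.ideal W).IsHomogeneous 𝒜)
    (n : ℕ) : ((R.piece n).ideal W).IsHomogeneous 𝒜 :=
  hadm.2.2 j W 𝒜 h0 hX n

/-- **The Rees filtration with the pieces of an admissible centre** (its pieces are antitone because it is a
regular weighted centre, `antitone_piece`). [folklore] -/
def filtration (hadm : IsAdmissibleCentre f X R) : ReesFiltration Y where
  ideal := R.piece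
  ideal_zero := R.piece_zero
  antitone := antitone_piece hadm.1
  mul_le := R.piece_mul_le

/-- The filtration of an admissible centre has its pieces. [folklore] -/
@[simp] theorem filtration_ideal (hadm : IsAdmissibleCentre f X R) : hadm.filtration.ideal = R.piece := rfl

/-- Any Rees filtration with the pieces of the admissible centre IS `hadm.filtration`
(`reesFiltration_eq_of_ideal_eq`). [folklore] -/
theorem eq_filtration (hadm : IsAdmissibleCentre f X R) {R' : ReesFiltration Y}
    (hR' : R'.ideal = R.piece) : R' = hadm.filtration :=
  reesFiltration_eq_of_ideal_eq (hR'.trans hadm.filtration_ideal.symm)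

/-- **The generic point of the integral hypersurface is off an admissible centre** (`(iii-b′)` +
`not_mem_singImage_subschemeι_genericPoint`). [folklore] -/
theorem genericPoint_not_mem_support (hadm : IsAdmissibleCentre f X R) [IsIntegral X.subscheme] :
    X.subschemeι (genericPoint X.subscheme) ∉ R.support :=
  fun h => not_mem_singImage_subschemeι_genericPoint X (hadm.2.1 h)

/-- **The successor of a hypersurface pair along an admissible centre is a hypersurface pair** (perfect
ground field): `B₊ → Y → Spec k` is smooth separated quasi-compact
(`smooth_πPlus_comp_of_isRegularWeightedCentre`), the strict transform is locally principal
(`isLocallyPrincipal_strictTransformPlus`, `Y` regular as smooth over a field) and has integral zero locus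
(`isIntegral_strictTransformPlus_of_not_mem_support`, the generic point being off the centre). [folklore] -/
theorem isHypersurfacePair_successor [PerfectField k] [Smooth f] [IsSeparated f] [QuasiCompact f]
    (hadm : IsAdmissibleCentre f X R) (hX : IsLocallyPrincipal X) (hXi : IsIntegral X.subscheme) :
    IsHypersurfacePair (hadm.filtration.πPlus ≫ f) (hadm.filtration.strictTransformPlus X) := by
  haveI : IsLocallyNoetherian Y := LocallyOfFiniteType.isLocallyNoetherian f
  haveI : IsIntegral X.subscheme := hXi
  have hY : Scheme.IsRegular Y := Scheme.IsRegular.of_smooth f (Scheme.isRegular_Spec (.of k))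
  obtain ⟨hs, hsep, hqc⟩ :=
    WeightedThesis.GlobalCobordantPlus.smooth_πPlus_comp_of_isRegularWeightedCentre f R hadm.1
      hadm.filtration rfl
  have hlp : IsLocallyPrincipal (hadm.filtration.strictTransformPlus X) :=
    WeightedThesis.HypersurfacePreserved.isLocallyPrincipal_strictTransformPlus hY R hadm.1
      hadm.filtration rfl X hX
  have hint : IsIntegral (hadm.filtration.strictTransformPlus X).subscheme := by
    have h' := (DatumToEmbedded.StrictTransform.isIntegral_strictTransformPlus_of_not_mem_support
      X.subschemeι R hadm.1 hadm.filtration rfl hadm.genericPoint_not_mem_support).1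
    rwa [Scheme.IdealSheafData.ker_subschemeι] at h'
  exact ⟨hs, hsep, hqc, hlp, hint⟩

end IsAdmissibleCentre

namespace HypersurfacePair

variable {k : Type} [Field k] [PerfectField k]

/-- **The successor of the hypersurface pair `P` along an admissible centre `R`** (perfect ground field),
as a hypersurface pair. [folklore] -/
abbrev admissibleSuccessor (P : HypersurfacePair k) (R : ReesAlgebraData P.Y)
    (hadm : IsAdmissibleCentre P.f P.X R) : HypersurfacePair k :=
  HypersurfacePair.ofIs (hadm.filtration.πPlus ≫ P.f) (hadm.filtration.strictTransformPlus P.X)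
    (hadm.isHypersurfacePair_successor P.isLocallyPrincipal P.isIntegral)

/-- **Bookkeeping-free step of the ∃-DOOR**: to resolve `P` admissibly in `n + 1` steps it suffices to give
an admissible centre `R` on `P` whose successor `P.admissibleSuccessor R hadm` is admissibly resolvable in
`n` steps — the successor data of `AdmissiblyResolvable` are supplied by
`IsAdmissibleCentre.isHypersurfacePair_successor`. [folklore] -/
theorem admissiblyResolvable_succ_of_admissible (P : HypersurfacePair k) (R : ReesAlgebraData P.Y)
    (hadm : IsAdmissibleCentre P.f P.X R) {n : ℕ}
    (h : AdmissiblyResolvable n (P.admissibleSuccessor R hadm)) : AdmissiblyResolvable (n + 1) P := by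
  obtain ⟨hs, hsep, hqc, hlp, hint⟩ := hadm.isHypersurfacePair_successor P.isLocallyPrincipal P.isIntegral
  exact (admissiblyResolvable_succ_iff P n).mpr
    ⟨R, hadm, hadm.filtration, rfl, hs, hsep, hqc, hlp, hint, h⟩

/-- Conversely, a head of an admissible resolution of length `n + 1` resolves its canonical successor in
`n` steps (the Rees filtration in the head is `hadm.filtration`, by uniqueness). [folklore] -/
theorem admissiblyResolvable_admissibleSuccessor_of_isHead (P : HypersurfacePair k)
    (R : ReesAlgebraData P.Y) {n : ℕ} (h : IsHead P n R) :
    AdmissiblyResolvable n (P.admissibleSuccessor R h.1) := by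
  obtain ⟨hadm, R', hR', hs, hsep, hqc, hlp, hint, hres⟩ := h
  obtain rfl : R' = hadm.filtration := hadm.eq_filtration hR'
  exact hres

/-- **The ∃-DOOR step as an equivalence**: `P` is admissibly resolvable in `n + 1` steps iff some admissible
centre on `P` has its successor admissibly resolvable in `n` steps. [folklore] -/
theorem admissiblyResolvable_succ_iff_exists_admissible (P : HypersurfacePair k) (n : ℕ) :
    AdmissiblyResolvable (n + 1) P ↔ ∃ (R : ReesAlgebraData P.Y) (hadm : IsAdmissibleCentre P.f P.X R),
      AdmissiblyResolvable n (P.admissibleSuccessor R hadm) := by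
  constructor
  · rintro ⟨R, hR⟩
    exact ⟨R, hR.1, P.admissiblyResolvable_admissibleSuccessor_of_isHead R hR⟩
  · rintro ⟨R, hadm, h⟩
    exact P.admissiblyResolvable_succ_of_admissible R hadm h

end HypersurfacePair

end Summit.ResolutionOfSingularities.ResolutionOfSingularities.Theorems

end
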